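import Mathlib
import HarnessLib
import Summits.HubbardSuperconductivity.HubbardSuperconductivity.Theorems.KLProgrammeKLRegimeVolumeLimitPerSiteDoors
import Summits.HubbardSuperconductivity.HubbardSuperconductivity.Theorems.KLProgrammeKLRegimeVolumeLimitInverseDressing

/-!
# VL children under the FLOW scheme (K3-FLOW RULING F): the bare nested export from a FRAMED nested export at VOLUME-DEPENDENT frames
# plus frame comparability — (K3F) Q-F4 in Lean, at the last scale
# (seat hubbard-kl-k3c5-p3 g7, VL co-registrant; technique «OS-positivity-free direct assembly»; `--supports` the VL child)

Route `KLProgramme`, crux K3 `KLRegimeTwoPointLimit`, child VOLUME-LIMIT (`VolumeLimitP2 Pr FinalTwoLegVolLimitEx W`; gen-7-flow bundle `klPredsV17F` with a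
DUMMY frame: the child reads the BARE last-scale carrier `Σ̂⁰_{L,M} = klSelfEnergy L M β U μ 0 klE0 (nScales β + 1)`).  Under scheme F the engine-flow lineage's
own objects at the last scale live in the DEFINED, volume- and cutoff-dependent frame `K^{(L,M)} = klFlowFrameU L M β U μ (nScales β + 1)`; its natural
two-volume pass therefore compares FRAMED carriers `Σ̂^{K^{(L,M)}}_{L,M}` against `Σ̂^{K^{(L″,M)}}_{L″,M}` and the frames `K^{(L,M)}` against `K^{(L″,M)}`.
This file converts exactly that pair of exports into the bare nested text, using the EXACT finite-cutoff dressing of this seat's g4 lineage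
(`Σ̂^K = (ĝ₀/ĝ_K)²·Σ̂⁰ + K·(ĝ₀/ĝ_K)`, `selfEnergy_fullActionCT_eq_schwingerDyson` + `propInt_sub_div_sq_eq`), inverted: `Σ̂⁰ = (ĝ_K/ĝ₀)²·Σ̂^K − K·(ĝ_K/ĝ₀)` with
`ĝ_K/ĝ₀ = 1 + K(q)·ĝ_K`, `‖ĝ_K‖ ≤ β/π` — so at equal momenta the bare difference is Lipschitz in the framed difference AND in the frame difference, with
constants depending only on `(β, U, μ)` and a sup bound `Kmax` of the frames:

* §1 `norm_propInt_le`, `propInt_div_propInt_zero_eq` (`ĝ_K/ĝ₀ = 1 + K(q)ĝ_K`; cf. k3c5-p2's one-frame `invDress` of …InverseDressing), `propInt_sub_propInt_eq`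
  (resolvent identity), and
  `klSelfEnergy_frame_dressing` — the finite-`M` dressing at the last scale whenever the bare normalised partition function is nonzero (eventually in `M`);
* §2 `norm_bare_sub_bare_le_of_framed` — the pointwise transfer estimate
  `‖Σ̂⁰₁ − Σ̂⁰₂‖ ≤ W²·‖Σ̂^{K₁}₁ − Σ̂^{K₂}₂‖ + C·|K₁(q) − K₂(q)|`, `W = 1 + Kmax·β/π`;
* §3 `perLabelBare_of_framedFlow` — per label: framed nested comparability at frames `Kf L M` + frame comparability at the coarse grid momenta + `|Kf| ≤ Kmax`
  ⇒ the bare per-label-thresholds text; §4 the door **`volumeLimitP2_of_framedFlowText (Pr W)`** — a VL child of any generation (in particular the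
  gen-7-flow child at `klPredsV17F`) from the engine-flow lineage's export IN ITS OWN FRAMES.

Everything is proved; no definition; nothing is asserted about the model (the frame family `Kf : ℕ → ℕ → TrigPolyC4v` is the supplier's — e.g.
`fun L M => klFlowFrameU L M β U μ (nScales β + 1)`).
-/

noncomputable section

namespace Summit.HubbardSuperconductivity.HubbardSuperconductivity.Theorems.TwoPointAssembly

set_option linter.dupNamespace false -- summit = problem name (single-conjunct summit), D-0017

open Finset Filter Topology Literature.MathematicalPhysics.QuantumLattice Literature.Probability.LatticeModels GrassmannAlgebra
open Literature.MathematicalPhysics.QuantumLattice.FermiRG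
open Summit.HubbardSuperconductivity.HubbardSuperconductivity.Theorems.DispersionFlow
open Summit.HubbardSuperconductivity.HubbardSuperconductivity.Theorems.KLRegimeSplit
open Summit.HubbardSuperconductivity.HubbardSuperconductivity.Theorems.KLProgrammeLegKernels

/-! ## §1 Propagator ratios and the finite-cutoff dressing at the last scale -/

/-- `‖g_K(n,q)‖ ≤ β/π` for every frame, label and momentum (`β > 0`). -/
theorem norm_propInt_le {β : ℝ} (hβ : 0 < β) (μ : ℝ) (K : TrigPolyC4v) (n : ℤ) (q : Fin 2 → ℝ) : ‖propInt β μ K n q‖ ≤ β / Real.pi := by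
  have hω : Real.pi / β ≤ |freqOfInt β n| := by
    have h := Literature.MathematicalPhysics.QuantumLattice.pi_div_le_abs_fermiMatsubara hβ n
    simp only [fermiMatsubara] at h
    exact h
  have hω0 : freqOfInt β n ≠ 0 := freqOfInt_ne_zero hβ.ne' n
  rw [propInt]
  refine (norm_one_div_le hω0 _).trans ?_
  rw [div_le_div_iff₀ (abs_pos.mpr hω0) Real.pi_pos, one_mul]
  have := mul_le_mul_of_nonneg_right hω hβ.le
  rwa [div_mul_cancel₀ _ hβ.ne', mul_comm] at this

/-- **`g_K/g₀ = 1 + K(q)·g_K`** (the inverse dressing; `β ≠ 0`). -/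
theorem propInt_div_propInt_zero_eq {β : ℝ} (hβ : β ≠ 0) (μ : ℝ) (K : TrigPolyC4v) (n : ℤ) (q : Fin 2 → ℝ) :
    propInt β μ K n q / propInt β μ 0 n q = 1 + (K.eval q : ℂ) * propInt β μ K n q := by
  have hD0 := propInt_den_ne_zero hβ μ 0 n q
  have hDK := propInt_den_ne_zero hβ μ K n q
  set dK : ℂ := -Complex.I * (freqOfInt β n : ℂ) + (bandCT μ K q : ℂ) with hdK
  set d0 : ℂ := -Complex.I * (freqOfInt β n : ℂ) + (bandCT μ 0 q : ℂ) with hd0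
  have hrel : (K.eval q : ℂ) = d0 - dK := by
    rw [hd0, hdK]; simp only [bandCT, TrigPolyC4v.eval_zero]; push_cast; ring
  have h1 : propInt β μ K n q = 1 / dK := rfl
  have h2 : propInt β μ 0 n q = 1 / d0 := rfl
  rw [h1, h2, hrel]
  field_simp
  ring

/-- **Resolvent identity**: `g_{K₁} − g_{K₂} = (K₁(q) − K₂(q))·g_{K₁}·g_{K₂}` (`β ≠ 0`). -/
theorem propInt_sub_propInt_eq {β : ℝ} (hβ : β ≠ 0) (μ : ℝ) (K₁ K₂ : TrigPolyC4v) (n : ℤ) (q : Fin 2 → ℝ) :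
    propInt β μ K₁ n q - propInt β μ K₂ n q = ((K₁.eval q - K₂.eval q : ℝ) : ℂ) * (propInt β μ K₁ n q * propInt β μ K₂ n q) := by
  have hD1 := propInt_den_ne_zero hβ μ K₁ n q
  have hD2 := propInt_den_ne_zero hβ μ K₂ n q
  set d1 : ℂ := -Complex.I * (freqOfInt β n : ℂ) + (bandCT μ K₁ q : ℂ) with hd1
  set d2 : ℂ := -Complex.I * (freqOfInt β n : ℂ) + (bandCT μ K₂ q : ℂ) with hd2
  have hrel : ((K₁.eval q - K₂.eval q : ℝ) : ℂ) = d2 - d1 := by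
    rw [hd1, hd2]; simp only [bandCT]; push_cast; ring
  have h1 : propInt β μ K₁ n q = 1 / d1 := rfl
  have h2 : propInt β μ K₂ n q = 1 / d2 := rfl
  rw [h1, h2, hrel]
  field_simp

section Dressing

variable {L : ℕ} [NeZero L]

/-- **The exact finite-cutoff dressing of the VL carrier at the last scale** (every coupling, frame, spin; `β > 0`): whenever the bare normalised
partition function at cutoff `M` is nonzero (true eventually in `M`, `tendsto_effPartitionFn_klDInf`),
`Σ̂^K_{L,M}((ω,p),σ) = (g₀/g_K)²·Σ̂⁰_{L,M}((ω,p),↑) + K(p_k)·(g₀/g_K)` with `g_J = propInt β μ J (matsubaraInt M ω) (latticeMomentum L p)`. -/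
theorem klSelfEnergy_frame_dressing {β : ℝ} (hβ : 0 < β) (U μ : ℝ) (K : TrigPolyC4v) {M : ℕ} [NeZero M]
    (hD : effPartitionFn ℂ (hubbardCovariance L M β μ 0) (hubbardInteraction L M β U) ≠ 0) (ω : MatsubaraIdx M) (p : TorusSite 2 L) (σ : Fin 2) :
    klSelfEnergy L M β U μ K klE0 (nScales β + 1) (ω, p) σ =
      (propInt β μ 0 (matsubaraInt M ω) (latticeMomentum L p) / propInt β μ K (matsubaraInt M ω) (latticeMomentum L p)) ^ 2 *
          klSelfEnergy L M β U μ 0 klE0 (nScales β + 1) (ω, p) 0 +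
        (K.eval (latticeMomentum L p) : ℂ) *
          (propInt β μ 0 (matsubaraInt M ω) (latticeMomentum L p) / propInt β μ K (matsubaraInt M ω) (latticeMomentum L p)) := by
  rw [klSelfEnergy_nScales_succ_spin_eq, klSelfEnergy_nScales_succ_eq_selfEnergy_fullActionCT hβ,
    klSelfEnergy_nScales_succ_eq_selfEnergy_fullActionCT hβ, selfEnergy_fullActionCT_eq_schwingerDyson hβ.ne' U μ K (ω, p) 0 hD,
    propCT_eq_propInt, propCT_eq_propInt, propInt_sub_div_sq_eq hβ.ne']

end Dressing

/-! ## §2 The pointwise transfer estimate -/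

/-- **Bare from framed, two frames, one momentum.**  Let `gᵢ = g_{Kᵢ}(n,q)`, `g₀ = g₀(n,q)`, `rᵢ = g₀/gᵢ`, and suppose `Sᵢ = rᵢ²·Bᵢ + Kᵢ(q)·rᵢ` (the dressing
of §1 at two volumes with frames `K₁`, `K₂`), `|Kᵢ(q)| ≤ Kmax`, `‖B₂‖ ≤ Bb`.  Then with `W = 1 + Kmax·β/π`:
`‖B₁ − B₂‖ ≤ W²·‖S₁ − S₂‖ + (W + (2W·(W²Bb + Kmax·W) + Kmax)·(β/π)·W)·|K₁(q) − K₂(q)|`. -/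
theorem norm_bare_sub_bare_le_of_framed {β : ℝ} (hβ : 0 < β) (μ : ℝ) (n : ℤ) (q : Fin 2 → ℝ) {K₁ K₂ : TrigPolyC4v} {Kmax Bb : ℝ}
    (hKmax : 0 ≤ Kmax) (hBb : 0 ≤ Bb) (hK₁ : |K₁.eval q| ≤ Kmax) (hK₂ : |K₂.eval q| ≤ Kmax) {S₁ S₂ B₁ B₂ : ℂ}
    (h₁ : S₁ = (propInt β μ 0 n q / propInt β μ K₁ n q) ^ 2 * B₁ + (K₁.eval q : ℂ) * (propInt β μ 0 n q / propInt β μ K₁ n q))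
    (h₂ : S₂ = (propInt β μ 0 n q / propInt β μ K₂ n q) ^ 2 * B₂ + (K₂.eval q : ℂ) * (propInt β μ 0 n q / propInt β μ K₂ n q))
    (hB₂ : ‖B₂‖ ≤ Bb) :
    ‖B₁ - B₂‖ ≤ (1 + Kmax * (β / Real.pi)) ^ 2 * ‖S₁ - S₂‖ +
      ((1 + Kmax * (β / Real.pi)) + (2 * (1 + Kmax * (β / Real.pi)) * ((1 + Kmax * (β / Real.pi)) ^ 2 * Bb + Kmax * (1 + Kmax * (β / Real.pi))) + Kmax) *
        (β / Real.pi) * (1 + Kmax * (β / Real.pi))) * |K₁.eval q - K₂.eval q| := by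
  set b : ℝ := β / Real.pi with hb
  have hb0 : 0 ≤ b := by positivity
  set W : ℝ := 1 + Kmax * b with hW
  have hW1 : 1 ≤ W := le_add_of_nonneg_right (mul_nonneg hKmax hb0)
  have hW0 : 0 ≤ W := zero_le_one.trans hW1
  set g₀ : ℂ := propInt β μ 0 n q with hg₀
  set g₁ : ℂ := propInt β μ K₁ n q with hg₁
  set g₂ : ℂ := propInt β μ K₂ n q with hg₂
  set κ₁ : ℝ := K₁.eval q with hκ₁
  set κ₂ : ℝ := K₂.eval q with hκ₂
  have hg₀ne : g₀ ≠ 0 := propInt_ne_zero hβ.ne' μ 0 n q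
  have hg₁ne : g₁ ≠ 0 := propInt_ne_zero hβ.ne' μ K₁ n q
  have hg₂ne : g₂ ≠ 0 := propInt_ne_zero hβ.ne' μ K₂ n q
  have hng₀ : ‖g₀‖ ≤ b := norm_propInt_le hβ μ 0 n q
  have hng₁ : ‖g₁‖ ≤ b := norm_propInt_le hβ μ K₁ n q
  have hng₂ : ‖g₂‖ ≤ b := norm_propInt_le hβ μ K₂ n q
  -- the inverse dressings `wᵢ = gᵢ/g₀ = 1 + κᵢ gᵢ`
  set w₁ : ℂ := g₁ / g₀ with hw₁
  set w₂ : ℂ := g₂ / g₀ with hw₂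
  have hw₁' : w₁ = 1 + (κ₁ : ℂ) * g₁ := propInt_div_propInt_zero_eq hβ.ne' μ K₁ n q
  have hw₂' : w₂ = 1 + (κ₂ : ℂ) * g₂ := propInt_div_propInt_zero_eq hβ.ne' μ K₂ n q
  have hnw : ∀ {w g : ℂ} {κ : ℝ}, w = 1 + (κ : ℂ) * g → |κ| ≤ Kmax → ‖g‖ ≤ b → ‖w‖ ≤ W := by
    intro w g κ hw hκ hg
    rw [hw]
    calc ‖1 + (κ : ℂ) * g‖ ≤ ‖(1 : ℂ)‖ + ‖(κ : ℂ) * g‖ := norm_add_le _ _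
      _ = 1 + |κ| * ‖g‖ := by rw [norm_one, norm_mul, Complex.norm_real, Real.norm_eq_abs]
      _ ≤ 1 + Kmax * b := by gcongr
  have hnw₁ : ‖w₁‖ ≤ W := hnw hw₁' hK₁ hng₁
  have hnw₂ : ‖w₂‖ ≤ W := hnw hw₂' hK₂ hng₂
  -- `w₁ − w₂ = (κ₁ − κ₂) g₁ + κ₂ (g₁ − g₂)`, `g₁ − g₂ = (κ₁ − κ₂) g₁ g₂`
  have hgsub : g₁ - g₂ = ((κ₁ - κ₂ : ℝ) : ℂ) * (g₁ * g₂) := propInt_sub_propInt_eq hβ.ne' μ K₁ K₂ n q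
  have hwsub : w₁ - w₂ = ((κ₁ - κ₂ : ℝ) : ℂ) * g₁ + (κ₂ : ℂ) * (((κ₁ - κ₂ : ℝ) : ℂ) * (g₁ * g₂)) := by
    rw [hw₁', hw₂', ← hgsub]; push_cast; ring
  have hnwsub : ‖w₁ - w₂‖ ≤ |κ₁ - κ₂| * (b * W) := by
    rw [hwsub]
    calc ‖((κ₁ - κ₂ : ℝ) : ℂ) * g₁ + (κ₂ : ℂ) * (((κ₁ - κ₂ : ℝ) : ℂ) * (g₁ * g₂))‖
        ≤ ‖((κ₁ - κ₂ : ℝ) : ℂ) * g₁‖ + ‖(κ₂ : ℂ) * (((κ₁ - κ₂ : ℝ) : ℂ) * (g₁ * g₂))‖ := norm_add_le _ _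
      _ = |κ₁ - κ₂| * ‖g₁‖ + |κ₂| * (|κ₁ - κ₂| * (‖g₁‖ * ‖g₂‖)) := by
          simp only [norm_mul, Complex.norm_real, Real.norm_eq_abs]
      _ ≤ |κ₁ - κ₂| * b + Kmax * (|κ₁ - κ₂| * (b * b)) := by gcongr
      _ = |κ₁ - κ₂| * (b * (1 + Kmax * b)) := by ring
  -- the inverse identities `Bᵢ = Sᵢ wᵢ² − κᵢ wᵢ`
  have hrw₁ : g₀ / g₁ * w₁ = 1 := by rw [hw₁]; field_simp
  have hrw₂ : g₀ / g₂ * w₂ = 1 := by rw [hw₂]; field_simp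
  have hB₁ : B₁ = S₁ * w₁ ^ 2 - (κ₁ : ℂ) * w₁ := by
    have : S₁ * w₁ ^ 2 = B₁ * (g₀ / g₁ * w₁) ^ 2 + (κ₁ : ℂ) * w₁ * (g₀ / g₁ * w₁) := by
      rw [h₁]; ring
    rw [this, hrw₁]; ring
  have hB₂' : B₂ = S₂ * w₂ ^ 2 - (κ₂ : ℂ) * w₂ := by
    have : S₂ * w₂ ^ 2 = B₂ * (g₀ / g₂ * w₂) ^ 2 + (κ₂ : ℂ) * w₂ * (g₀ / g₂ * w₂) := by
      rw [h₂]; ring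
    rw [this, hrw₂]; ring
  -- a bound on `S₂` from `B₂`: `S₂ = r₂² B₂ + κ₂ r₂`, `‖r₂‖ ≤ W`
  have hr₂ : g₀ / g₂ = 1 - (κ₂ : ℂ) * g₀ := propInt_zero_div_propInt_eq hβ.ne' μ K₂ n q
  have hnr₂ : ‖g₀ / g₂‖ ≤ W := by
    rw [hr₂]
    calc ‖1 - (κ₂ : ℂ) * g₀‖ ≤ ‖(1 : ℂ)‖ + ‖(κ₂ : ℂ) * g₀‖ := norm_sub_le _ _
      _ = 1 + |κ₂| * ‖g₀‖ := by rw [norm_one, norm_mul, Complex.norm_real, Real.norm_eq_abs]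
      _ ≤ 1 + Kmax * b := by gcongr
  have hS₂ : ‖S₂‖ ≤ W ^ 2 * Bb + Kmax * W := by
    rw [h₂]
    calc ‖(g₀ / g₂) ^ 2 * B₂ + (κ₂ : ℂ) * (g₀ / g₂)‖
        ≤ ‖(g₀ / g₂) ^ 2 * B₂‖ + ‖(κ₂ : ℂ) * (g₀ / g₂)‖ := norm_add_le _ _
      _ = ‖g₀ / g₂‖ ^ 2 * ‖B₂‖ + |κ₂| * ‖g₀ / g₂‖ := by
          rw [norm_mul, norm_pow, norm_mul, Complex.norm_real, Real.norm_eq_abs]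
      _ ≤ W ^ 2 * Bb + Kmax * W := by gcongr
  -- assemble: `B₁ − B₂ = (S₁ − S₂) w₁² + S₂ (w₁ − w₂)(w₁ + w₂) − (κ₁ − κ₂) w₁ − κ₂ (w₁ − w₂)`
  have hdiff : B₁ - B₂ = (S₁ - S₂) * w₁ ^ 2 + S₂ * ((w₁ - w₂) * (w₁ + w₂)) - ((κ₁ - κ₂ : ℝ) : ℂ) * w₁ - (κ₂ : ℂ) * (w₁ - w₂) := by
    rw [hB₁, hB₂']; push_cast; ring
  rw [hdiff]
  have hww : ‖w₁ + w₂‖ ≤ 2 * W := (norm_add_le _ _).trans (by linarith)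
  calc ‖(S₁ - S₂) * w₁ ^ 2 + S₂ * ((w₁ - w₂) * (w₁ + w₂)) - ((κ₁ - κ₂ : ℝ) : ℂ) * w₁ - (κ₂ : ℂ) * (w₁ - w₂)‖
      ≤ ‖(S₁ - S₂) * w₁ ^ 2‖ + ‖S₂ * ((w₁ - w₂) * (w₁ + w₂))‖ + ‖((κ₁ - κ₂ : ℝ) : ℂ) * w₁‖ + ‖(κ₂ : ℂ) * (w₁ - w₂)‖ := by
        have h1 := norm_sub_le ((S₁ - S₂) * w₁ ^ 2 + S₂ * ((w₁ - w₂) * (w₁ + w₂)) - ((κ₁ - κ₂ : ℝ) : ℂ) * w₁) ((κ₂ : ℂ) * (w₁ - w₂))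
        have h2 := norm_sub_le ((S₁ - S₂) * w₁ ^ 2 + S₂ * ((w₁ - w₂) * (w₁ + w₂))) (((κ₁ - κ₂ : ℝ) : ℂ) * w₁)
        have h3 := norm_add_le ((S₁ - S₂) * w₁ ^ 2) (S₂ * ((w₁ - w₂) * (w₁ + w₂)))
        linarith
    _ = ‖S₁ - S₂‖ * ‖w₁‖ ^ 2 + ‖S₂‖ * (‖w₁ - w₂‖ * ‖w₁ + w₂‖) + |κ₁ - κ₂| * ‖w₁‖ + |κ₂| * ‖w₁ - w₂‖ := by
        simp only [norm_mul, norm_pow, Complex.norm_real, Real.norm_eq_abs]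
    _ ≤ ‖S₁ - S₂‖ * W ^ 2 + (W ^ 2 * Bb + Kmax * W) * ((|κ₁ - κ₂| * (b * W)) * (2 * W)) + |κ₁ - κ₂| * W + Kmax * (|κ₁ - κ₂| * (b * W)) := by
        gcongr
    _ = W ^ 2 * ‖S₁ - S₂‖ + (W + (2 * W * (W ^ 2 * Bb + Kmax * W) + Kmax) * b * W) * |κ₁ - κ₂| := by ring

/-! ## §3 Per label: framed nested data at volume-dependent frames + frame comparability ⇒ the bare per-label-thresholds text -/

section Flow

variable {β U : ℝ}

/-- **The bare per-label nested text from the FLOW lineage's export** (one Matsubara integer `n`; `U ≠ 0`, `β > 0`).  Inputs: a frame family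
`Kf L M` (the supplier's — e.g. the flow frame at the last scale) with `|Kf L M (q)| ≤ Kmax`; nested same-momentum comparability of the FRAMED carriers
`klSelfEnergy L M β U μ (Kf L M) klE0 (nScales β + 1) (ω,k) 0` vs `klSelfEnergy L″ M β U μ (Kf L″ M) … (ω,k″) 0` at the labels `matsubaraInt M ω = n` with a rate
`ρ L → 0` beyond `L₀`; comparability of the frames at the coarse grid momenta with a rate `ρ′ L → 0` beyond `L₀′` (same cutoff at both volumes, eventually in
`M`).  Output: the `hN` text of `volumeLimitP2_of_perLabelThresholdsOnlyText` at this `n` (threshold `max L₀ L₀′ 3`, rate `W²ρ + C ρ′`). -/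
theorem perLabelBare_of_framedFlow (hβ : 0 < β) (hU : U ≠ 0) (μ : ℝ) (n : ℤ) (Kf : ℕ → ℕ → TrigPolyC4v) {Kmax : ℝ} (hKmax : 0 ≤ Kmax)
    (hKf : ∀ (L M : ℕ) (q : Fin 2 → ℝ), |(Kf L M).eval q| ≤ Kmax)
    (hS : ∃ L₀ : ℕ, ∃ ρ : ℕ → ℝ, Tendsto ρ atTop (𝓝 0) ∧
      ∀ (L : ℕ) [NeZero L], L₀ ≤ L → ∀ (L'' : ℕ) [NeZero L''], L ∣ L'' → ∃ M₀ : ℕ, ∀ (M : ℕ) [NeZero M], M₀ ≤ M →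
        ∀ (ω : MatsubaraIdx M), matsubaraInt M ω = n → ∀ (k : TorusSite 2 L) (k'' : TorusSite 2 L''),
          latticeMomentum L'' k'' = latticeMomentum L k →
            ‖klSelfEnergy L M β U μ (Kf L M) klE0 (nScales β + 1) (ω, k) 0 -
                klSelfEnergy L'' M β U μ (Kf L'' M) klE0 (nScales β + 1) (ω, k'') 0‖ ≤ ρ L)
    (hF : ∃ L₀ : ℕ, ∃ ρ : ℕ → ℝ, Tendsto ρ atTop (𝓝 0) ∧
      ∀ (L : ℕ) [NeZero L], L₀ ≤ L → ∀ (L'' : ℕ) [NeZero L''], L ∣ L'' → ∃ M₀ : ℕ, ∀ (M : ℕ) [NeZero M], M₀ ≤ M →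
        ∀ k : TorusSite 2 L, |(Kf L M).eval (latticeMomentum L k) - (Kf L'' M).eval (latticeMomentum L k)| ≤ ρ L) :
    ∃ L₀ : ℕ, ∃ ρ : ℕ → ℝ, Tendsto ρ atTop (𝓝 0) ∧
      ∀ (L : ℕ) [NeZero L], L₀ ≤ L → ∀ (L'' : ℕ) [NeZero L''], L ∣ L'' → ∃ M₀ : ℕ, ∀ (M : ℕ) [NeZero M], M₀ ≤ M →
        ∀ (ω : MatsubaraIdx M), matsubaraInt M ω = n → ∀ (k : TorusSite 2 L) (k'' : TorusSite 2 L''),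
          latticeMomentum L'' k'' = latticeMomentum L k →
            ‖klSelfEnergy L M β U μ 0 klE0 (nScales β + 1) (ω, k) 0 -
                klSelfEnergy L'' M β U μ 0 klE0 (nScales β + 1) (ω, k'') 0‖ ≤ ρ L := by
  obtain ⟨L₁, ρ₁, hρ₁, hS⟩ := hS
  obtain ⟨L₂, ρ₂, hρ₂, hF⟩ := hF
  have hBb0 : (0 : ℝ) ≤ 3 / 2 * |U| + 9 / 4 * β * U ^ 2 + 1 := by positivity
  -- the two constants of `norm_bare_sub_bare_le_of_framed` at `Bb = 3/2|U| + 9/4βU² + 1`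
  have hA0 : (0 : ℝ) ≤ (1 + Kmax * (β / Real.pi)) ^ 2 := by positivity
  have hC0 : (0 : ℝ) ≤ ((1 + Kmax * (β / Real.pi)) +
      (2 * (1 + Kmax * (β / Real.pi)) * ((1 + Kmax * (β / Real.pi)) ^ 2 * (3 / 2 * |U| + 9 / 4 * β * U ^ 2 + 1) +
        Kmax * (1 + Kmax * (β / Real.pi))) + Kmax) * (β / Real.pi) * (1 + Kmax * (β / Real.pi))) := by positivity
  refine ⟨max (max L₁ L₂) 3, fun L => (1 + Kmax * (β / Real.pi)) ^ 2 * ρ₁ L +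
      ((1 + Kmax * (β / Real.pi)) +
        (2 * (1 + Kmax * (β / Real.pi)) * ((1 + Kmax * (β / Real.pi)) ^ 2 * (3 / 2 * |U| + 9 / 4 * β * U ^ 2 + 1) +
          Kmax * (1 + Kmax * (β / Real.pi))) + Kmax) * (β / Real.pi) * (1 + Kmax * (β / Real.pi))) * ρ₂ L, ?_,
    fun L _ hL L'' _ hdvd => ?_⟩
  · simpa using (hρ₁.const_mul ((1 + Kmax * (β / Real.pi)) ^ 2)).add
      (hρ₂.const_mul ((1 + Kmax * (β / Real.pi)) +
        (2 * (1 + Kmax * (β / Real.pi)) * ((1 + Kmax * (β / Real.pi)) ^ 2 * (3 / 2 * |U| + 9 / 4 * β * U ^ 2 + 1) +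
          Kmax * (1 + Kmax * (β / Real.pi))) + Kmax) * (β / Real.pi) * (1 + Kmax * (β / Real.pi))))
  have hL1 : L₁ ≤ L := (le_max_left _ _).trans ((le_max_left _ _).trans hL)
  have hL2 : L₂ ≤ L := (le_max_right _ _).trans ((le_max_left _ _).trans hL)
  have hL3 : 3 ≤ L := (le_max_right _ _).trans hL
  have hL3'' : 3 ≤ L'' := hL3.trans (Nat.le_of_dvd (Nat.pos_of_ne_zero (NeZero.ne L'')) hdvd)
  obtain ⟨M₁, hM₁⟩ := hS L hL1 L'' hdvd
  obtain ⟨M₂, hM₂⟩ := hF L hL2 L'' hdvd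
  -- partition functions nonzero at both volumes, eventually in `M`
  obtain ⟨M₃, hM₃⟩ := Filter.eventually_atTop.1 ((tendsto_effPartitionFn_klDInf hL3 hβ U μ).eventually_ne (klDInf_ne_zero β U μ))
  obtain ⟨M₄, hM₄⟩ := Filter.eventually_atTop.1 ((tendsto_effPartitionFn_klDInf hL3'' hβ U μ).eventually_ne (klDInf_ne_zero β U μ))
  -- the bare carrier at the fine volume is bounded by `Bb` eventually in `M`
  obtain ⟨M₅, hM₅⟩ := eventually_norm_klSelfEnergy_le_of_inf_bound hL3'' hβ U μ 0 (fun n' p => norm_klSelfEnergyInf_zero_le hL3'' hβ hU μ n' p)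
  refine ⟨max (max (max M₁ M₂) (max M₃ M₄)) M₅, fun M _ hM ω hω k k'' hkk => ?_⟩
  have hMM₁ : M₁ ≤ M := (le_max_left _ _).trans ((le_max_left _ _).trans ((le_max_left _ _).trans hM))
  have hMM₂ : M₂ ≤ M := (le_max_right _ _).trans ((le_max_left _ _).trans ((le_max_left _ _).trans hM))
  have hMM₃ : M₃ ≤ M := (le_max_left _ _).trans ((le_max_right _ _).trans ((le_max_left _ _).trans hM))
  have hMM₄ : M₄ ≤ M := (le_max_right _ _).trans ((le_max_right _ _).trans ((le_max_left _ _).trans hM))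
  have hMM₅ : M₅ ≤ M := (le_max_right _ _).trans hM
  have hD := hM₃ M hMM₃
  have hD'' := hM₄ M hMM₄
  -- the two dressings, at the common momentum `q = p_k = p_{k″}` and label `n`
  have h₁ := klSelfEnergy_frame_dressing hβ U μ (Kf L M) hD ω k 0
  have h₂ := klSelfEnergy_frame_dressing hβ U μ (Kf L'' M) hD'' ω k'' 0
  rw [hkk, hω] at h₂
  rw [hω] at h₁
  have hest := norm_bare_sub_bare_le_of_framed hβ μ n (latticeMomentum L k) hKmax hBb0 (hKf L M _) (hKf L'' M _) h₁ h₂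
    (hM₅ M hMM₅ (ω, k'') 0)
  refine hest.trans ?_
  have hs := hM₁ M hMM₁ ω hω k k'' hkk
  have hf := hM₂ M hMM₂ k
  exact add_le_add (mul_le_mul_of_nonneg_left hs hA0) (mul_le_mul_of_nonneg_left hf hC0)

end Flow

/-! ## §4 The door: a VL child from the engine-flow lineage's export IN ITS OWN FRAMES -/

/-- **A VL child (any `Pr`, `W`) from a FRAMED nested export at volume-dependent frames plus frame comparability** — the scheme-F interface ((K3F) Q-F4):
inside the regime binders the supplier names a frame family `Kf : ℕ → ℕ → TrigPolyC4v` (e.g. the flow frame at the last scale) with a sup bound `Kmax`,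
and delivers (i) for each Matsubara integer `n`, nested same-momentum comparability of the framed last-scale carriers `Σ̂^{Kf L M}_{L,M}` vs `Σ̂^{Kf L″ M}_{L″,M}`
(label-dependent threshold and rate), and (ii) comparability of the frames `Kf L M` vs `Kf L″ M` at the coarse grid momenta (nested volumes, same cutoff,
eventually in `M`, one rate).  The bare nested text, hence the child, follows by the exact last-scale dressing. -/
theorem volumeLimitP2_of_framedFlowText (Pr : Preds) (W : Set ℝ)
    (hPr : ∀ (R : RenConsts) (U : ℝ) (N : ℕ) (μ : ℝ) (K : TrigPolyC4v), Pr.frameOK R U N μ K → FrameOK R U N μ K)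
    (hX : ∀ (G : GeoConsts) (P : SplitConsts) (Q : EngConsts) (R : RenConsts), G.WF → P.WF → Q.WF → R.WF →
      ∃ c₅ : ℝ, 0 < c₅ ∧ ∀ c : ℝ, 0 < c → c ≤ c₅ → ∃ U₀ : ℝ, 0 < U₀ ∧
        ∀ μ ∈ W, ∀ U : ℝ, 0 < U → U ≤ U₀ → ∀ β : ℝ, klBetaMin ≤ β → β ≤ Real.exp (c / U ^ 2) →
          ∀ K : TrigPolyC4v, Pr.frameOK R U (nScales β) μ K →
            ∀ (Lstar : ℕ) (Mstar : ℕ → ℕ), TowerP Pr G P Q R β U μ K Lstar Mstar →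
              ∃ Kf : ℕ → ℕ → TrigPolyC4v, ∃ Kmax : ℝ, 0 ≤ Kmax ∧ (∀ (L M : ℕ) (q : Fin 2 → ℝ), |(Kf L M).eval q| ≤ Kmax) ∧
                (∀ n : ℤ, ∃ L₀ : ℕ, ∃ ρ : ℕ → ℝ, Tendsto ρ atTop (𝓝 0) ∧
                  ∀ (L : ℕ) [NeZero L], L₀ ≤ L → ∀ (L'' : ℕ) [NeZero L''], L ∣ L'' → ∃ M₀ : ℕ, ∀ (M : ℕ) [NeZero M], M₀ ≤ M →
                    ∀ (ω : MatsubaraIdx M), matsubaraInt M ω = n → ∀ (k : TorusSite 2 L) (k'' : TorusSite 2 L''),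
                      latticeMomentum L'' k'' = latticeMomentum L k →
                        ‖klSelfEnergy L M β U μ (Kf L M) klE0 (nScales β + 1) (ω, k) 0 -
                            klSelfEnergy L'' M β U μ (Kf L'' M) klE0 (nScales β + 1) (ω, k'') 0‖ ≤ ρ L) ∧
                (∃ L₀ : ℕ, ∃ ρ : ℕ → ℝ, Tendsto ρ atTop (𝓝 0) ∧
                  ∀ (L : ℕ) [NeZero L], L₀ ≤ L → ∀ (L'' : ℕ) [NeZero L''], L ∣ L'' → ∃ M₀ : ℕ, ∀ (M : ℕ) [NeZero M], M₀ ≤ M →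
                    ∀ k : TorusSite 2 L, |(Kf L M).eval (latticeMomentum L k) - (Kf L'' M).eval (latticeMomentum L k)| ≤ ρ L)) :
    VolumeLimitP2 Pr FinalTwoLegVolLimitEx W := by
  refine volumeLimitP2_of_perLabelThresholdsOnlyText Pr W hPr ?_
  intro G P Q R hG hP hQ hR
  obtain ⟨c₅, hc₅, hc⟩ := hX G P Q R hG hP hQ hR
  refine ⟨c₅, hc₅, fun c hc0 hcc => ?_⟩
  obtain ⟨U₀, hU₀, hU⟩ := hc c hc0 hcc
  refine ⟨U₀, hU₀, fun μ hμ U hU0 hUU β hβmin hβmax K hK Lstar Mstar hT n => ?_⟩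
  obtain ⟨Kf, Kmax, hKmax, hKf, hS, hF⟩ := hU μ hμ U hU0 hUU β hβmin hβmax K hK Lstar Mstar hT
  exact perLabelBare_of_framedFlow (pos_of_klBetaMin_le hβmin) hU0.ne' μ n Kf hKmax hKf (hS n) hF

end Summit.HubbardSuperconductivity.HubbardSuperconductivity.Theorems.TwoPointAssembly

end
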